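import Mathlib
import HarnessLib
import HarnessLib.Audit
import Summits.NavierStokesRegularity.Statement
import Summits.NavierStokesRegularity.NavierStokesRegularity.Theses.TaoLadderRungTwoBreak
import Literature.Analysis.FluidPDE.Tao2016AveragedNS.BoundedEternalSolutions
import HarnessLib.Audit.Status.Attr

/-!
Route: LatticeTransitLiouville

# Route LatticeTransitLiouville — scale-ratio → 1 limit lattice has no wake-free transit ⇒ rung M2
breaks

It suffices to show X = TransitExtraction ∧ NoLatticeTransit ∧ NoLoudLadderOne ∧
EternalRigidityViscBddOne. Dictionary (card
lattice-transit-liouville; every entry a tree decl): the scale-ratio → 1 limit (ε₀ → 0 at FIXED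
table spread R, amplitude renormalised,
time s = σ·‖W‖∞) of Tao's renormalised cascade is the λ = 1 translation-invariant,
energy-conserving, purely quadratic nearest-neighbour
lattice 𝓛_α: dV_n/ds = Q_α(V_n) + A_α(V_(n−1)) + B_α(V_(n+1), V_n); a surviving bounded (Type-I)
eternal solution ↦ a NON-EVANESCENT
WAKE-FREE TRANSIT of 𝓛_α (finite energy arriving from n = −∞, every shell draining as s → +∞,
amplitude bounded above and below); a DSS
pump ↦ a solitary travelling pulse; wake per hop ↦ residual shell energy; survival (wake < 1 −
(1+ε₀)⁻¹ ≈ ε₀) ↦ wake = 0. NoLatticeTransit is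
the Liouville theorem of the limit lattice, TransitExtraction the compactness step; with the host
route's ρ+ and K2ᵛ they close RUNG
TL-M2Break (Theses.TaoLadderRungTwoBreak.Target = ∀ R ≥ 1, NoRobustBlowupBelow R). This is a LINE on
a rung: no summit is proved by it.
Lean: `Summit.NavierStokesRegularity.NavierStokesRegularity.Theses.TaoLadderRungTwoBreak.Target`

## Assembly
Pure logic over two tree theorems (kernel-checked in Sketch.lean / glue.lean): TransitExtraction and
NoLatticeTransit give ∀ R ≥ 1,
NoSurvivingEternalBdd R 1 (by contradiction: a survivor family extracts a nontrivial transit, which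
NoLatticeTransit kills) — this is
literally item ρ0 (stmt-20451) of the host route; `TaoCascade.noSurvivingEternalViscBddOne_of` with
NoLoudLadderOne upgrades it to
NoSurvivingEternalViscBdd R 1; `TaoCascade.noRobustBlowupBelow_of_eternalViscBdd` with
EternalRigidityViscBddOne gives NoRobustBlowupBelow R
for every R ≥ 1, i.e. Theses.TaoLadderRungTwoBreak.Target (closes_target TaoLadderM2Break, class
rung).

CLOSES_TARGET: closes rung TL-M2Break of NavierStokesRegularity: Summit.NavierStokesRegularity.NavierStokesRegularity.Theses.TaoLadderRungTwoBreak.Target (D-0061; not the summit Statement) — the deciding theorem of this route concludes that registered leaf instead of the Statement decl `NavierStokesRegularity` (class rung: servable and labelled, never counted as concluding the summit Statement).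

Rationale: WHY THIS LINE. The host route TaoLadderRungTwoBreak (rev 12) reduced rung M2Break to ρ0 =
NoSurvivingEternalBddOne, whose own why-might-fail names "a
wake-free lattice solitary wave in the λ → 1 limit" as the enemy, and attacks it by an ε₀-explicit
wake census. This line imports LATTICE
TRAVELLING-WAVE THEORY with an explicit dictionary and makes the limit object itself the statement:
at λ = 1 the cascade is a parameter-free
translation-invariant conservative lattice, finite energy forces the zero background where a purely
quadratic lattice has no linear band, a
fresh shell can only be ignited by the additive source A_α(V_(n−1)), and additive sources create
"mass" (dyadic member: dM/ds = ½Σ(V_n − V_(n+1))²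
≥ 0) — the mechanism behind the cell's measured wake ≈ ε² for the seeded Toda member (kit j280208)
and its heuristic "pumps persist iff ε₀ ≳ cε²".
Sources: arXiv:1402.0290 §4–§6 (cascade, table class, the hierarchy 1/ε₀ ≪ K ≪ 1/ε comparable tables
lack); doi:10.1007/BF02101552
(Friesecke–Wattis: solitary waves on lattices exist by concentration-compactness — the refuting
instrument); [corpus:book:haragus2010-local-bifurcations-center-manifolds-normal-forms-infinite
p.275–277]
(travelling waves in lattices = advance-delay equations, centre manifolds);
[corpus:book:lombardi2000-oscillatory-integrals-phenomena-beyond-all-algebriac-orders p.32, p.345]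
(exact tail-free homoclinics are non-generic); doi:10.1016/S0167-2789(99)00190-6
(Andersen–Bohr–Jensen–Nielsen–Olesen 2000: pulses in the
zero-spacing CONTINUUM limit of GOY — the nearest prior art, a different scaling). What it does that
listed routes do not: no NS route uses a
limit lattice or a lattice Liouville theorem; the negatives index (5 entries) has no statement about
λ = 1 objects. PRIOR ART ADDED after critic idea-crit-3 (P4, 2026-08-27T21:02Z; references supplied
by the critic): Friesecke–Wattis 1994 / Friesecke–Pego 1999 (solitary waves exist in generic FPU
chains), English–Pego 2005 (compactons), Iooss–Kirchgässner 2000 and Lombardi 2000 (tail-free pulses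
of advance–delay equations are codimension one) — the literature default for conservative
nearest-neighbour quadratic lattices is that pulses EXIST; what breaks the default here is DIRECTED
coupling (shift set with non-negative shifts, no reversibility), which is therefore the load-bearing
structural input of K1.

RANKED CRUXES. #2 NoLatticeTransit (crux) — for every R ≥ 1 and every table α ∈ E₂(R) (InTableClass
R α), every solution V : ℤ → ℝ → ℝ⁴ of the λ = 1 lattice 𝓛_α that is bounded, non-evanescent (sup_n
‖V_n(s)‖ ≥ c > 0 for all s), square-summable at each time, drains below every shell as s → +∞ and
vanishes above every shell as s → −∞, is identically zero (card item K1). [difficulty: L] (why it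
might fail: E₂(R) is a ≥10-parameter compact family; exact tail-free pulses are codimension-one in
reversible advance-delay problems (Lombardi) and compact sonic-vacuum pulses exist in purely
nonlinear chains (Nesterenko; English–Pego 2005) — one such pulse for one comparable table kills
it.) [doi:10.1007/BF02101552,
book:lombardi2000-oscillatory-integrals-phenomena-beyond-all-algebriac-orders,
doi:10.1090/S0002-9939-05-07851-2, arXiv:1402.0290]
#3 TransitExtraction (crux) — if NoSurvivingEternalBdd R 1 fails (survivors W_(ε₀) for ε₀ → 0 on
tables α_(ε₀) ∈ E₂(R)), then recentring at the front, rescaling amplitude by ‖W‖∞ and time by ‖W‖∞⁻¹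
and passing to a diagonal limit (E₂(R) is compact) yields a limit table α ∈ E₂(R) and a bounded,
non-evanescent, finite-energy, completely draining, nontrivial eternal solution of 𝓛_α (card item
K2). [difficulty: L] (why it might fail: the amplitude rate ‖W‖∞ ≍ 1/ε₀ is unproved (UniformBound
carries no rate); fronts may widen or split as ε₀ → 0 (vanishing/dichotomy), and survival — an
ε₀-clock statement — may pass to the limit only as partial drain.) [arXiv:1402.0290,
doi:10.1007/BF02101552, Literature.Analysis.FluidPDE.Tao2016AveragedNS.BoundedEternalSolutions]
#4 NoLoudLadderOne (crux) — loud-ladder exclusion at exponent a = 1 for every spread R ≥ 1 (shared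
with route TaoLadderRungTwoBreak, item ρ+ = stmt-20452; same signature). [difficulty: M] (why it
might fail: a viscous eternal solution in which every shell reaches the dissipation-critical level
yet the front still outruns dissipation at small ε₀ (a "loud" surviving ladder) is not excluded by
any census so far.) [arXiv:1402.0290,
Literature.Analysis.FluidPDE.Tao2016AveragedNS.BoundedEternalSolutions]
#5 EternalRigidityViscBddOne (crux) — viscous eternal rigidity at exponent 1 for every R ≥ 1:
Theorem-4.2-level blow-up of an E₂(R) table below threshold forces a uniformly bounded surviving
viscous eternal solution (shared with route TaoLadderRungTwoBreak, item K2ᵛ = stmt-20420; same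
signature). [difficulty: L] (why it might fail: the compactness step from defect-tolerant blow-up
(NoGlobalCascade fails) to a UNIFORMLY BOUNDED eternal solution needs a Type-I bound that a
Type-II-like cascade on a comparable table might violate.) [arXiv:1402.0290,
Literature.Analysis.FluidPDE.Tao2016AveragedNS.BoundedEternalSolutions]

TWO-LAYER PLAN. NoLatticeTransit ⇐ IgnitionNeedsSource (a transit's support must see A_α ≠ 0:
multiplicative couplings cannot ignite a zero shell) →
SourceLeavesWake (∃ θ(R) > 0: every A_α-driven hop leaves residual energy ≥ θ · energy passed,
uniformly on E₂(R)) → NoLatticeTransit;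
TransitExtraction ⇐ FrontAmplitudeRate (survival at ratio 1+ε₀ with UniformBound forces ‖W(σ)‖∞ ≍
1/ε₀ at the front) → FrontTightness
(no dichotomy: the energy-carrying window has ε₀-uniform width in shells) → TransitExtraction.
Nothing filed now.

KILL CRITERIA. A localized travelling pulse (or any non-evanescent wake-free transit) of 𝓛_α for ONE
table α ∈ E₂(R₀) refutes NoLatticeTransit for all
R ≥ R₀: close `refuted:NoLatticeTransit` — and hand the pulse to the host route as a candidate
refutation of ρ0/K1ᵛ and to rung TL-M2 as a
constructive "solitary-pulse blow-up" mechanism (informative either way). TransitExtraction refuted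
by a widening-front survivor family ⇒
pivot: restate the limit object as the zero-spacing continuum limit (Andersen et al. scaling) with
its own Liouville crux. ρ0 (stmt-20451)
proved directly by the host route's census moots cruxes 2–3 (the line is then superseded);
NoLoudLadderOne or EternalRigidityViscBddOne
refuted breaks both routes at once.

NOT DECOMPOSED YET. The wake floor θ(R) and its dependence on R; the front-amplitude rate lemma; the
treatment of multi-pulse (N-soliton-like) transits; the
sign structure of A_α on E₂(R) (which tables have A_α ≡ 0 and are then trivially transit-free) — all
layer-2 children after a crux moves.

CHEAPEST FALSIFIER. INSTRUMENT ROW (re-specified after critic idea-crit-3 P1, 2026-08-27T21:02Z): by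
Iooss–Kirchgässner 2000 / Lombardi 2000 exactly tail-free pulses of the advance–delay profile
equation −cΦ′(ξ) = Q_α(Φ(ξ)) + A_α(Φ(ξ−1)) + B_α(Φ(ξ+1), Φ(ξ)) (c > 0, Φ → 0 at ±∞) are a
CODIMENSION-ONE phenomenon, so random sampling of tables generically misses them; the falsifier is a
ONE-PARAMETER CONTINUATION inside E₂(2) (Newton–Petviashvili on the profile equation with an
exponentially weighted tail functional = the Stokes constant of the beyond-all-orders tail),
monitoring the Stokes constant for a SIGN CHANGE along (i) the segment from `dyadicTable`
(prediction: no pulse — the travelling-pulse case is killed by ∫Φ(·−1)² = ∫ΦΦ(·+1) ≤ ∫Φ² with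
equality iff Φ is 1-periodic) to the cell's 4-mode circuit / seeded-Toda tables at seed → 0, and
(ii) two further generic segments of E₂(2); a sign change = a tail-free transit exists on that
segment and KILLS rank 2 (K1) for the class; no sign change on all segments supports it. The
DIRECTED coupling (shift set S with non-negative shifts, no reversibility) is the structural reason
to expect a two-sided generic tail, and the table-uniform identity the K1 proof must exhibit is the
directed energy flux: d/ds Σ_{n≤N} ‖V_n‖² = (flux through the triple at N) with a sign fixed by S.
Not run in this session; it is one `kit compute` job (continuation, minutes to an hour), the first
refuter action.

NUMBERS. Survival threshold: wake fraction per hop < 1 − (1+ε₀)⁻¹ ≈ ε₀ (energy identity in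
renormalised variables, arXiv:1402.0290 §4 (4.1)).
Cell measurement (host route dossier): seeded Toda member T_ε leaves wake ≈ ε² per hop (kit
j280208), pumps persist iff ε₀ ≳ c·ε².
dyadicTable ∈ E₂(R) for R ≥ 2 (`TaoCascade.inTableClass_dyadicTable`). Items at open: 4 cruxes, 0
support (glue proved inside glue.lean).

DEFINITION REQUESTS. None: InTableClass, tableQ, tableA, tableB, NoSurvivingEternalBdd,
NoLoudLadder, EternalRigidityViscBdd, NoRobustBlowupBelow are tree
declarations (namespace Literature.Analysis.FluidPDE.TaoCascade); the transit clauses are stated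
inline over Mathlib (HasDerivAt, Summable,
Filter.Tendsto, tsum).

Novelty: Searches (2026-08-27): lit search --hybrid "lattice differential equation traveling front" /
"solitary wave lattice Friesecke Wattis" / "shell model travelling wave self-similar" (corpus hits:
haragus2010 p.276, lombardi2000 p.345, kevrekidis2009 p.67, ditlevsen2010 p.28/115, patznd p.101,
arxiv-0811.2406 p.7, arxiv-1502.03937 p.17); lit search "Mailybaev renormalization universality
blowup" (corpus: arxiv-1409.4682, arxiv-2501.07377, arxiv-2005.14027, arxiv-2412.07064); lit search
"Dombre Gilson singular fluctuations shell model" (4 citing hits); lit galaxy search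
"quasi-soliton|quasisoliton|Dombre" --star all (24 rows, 0 relevant), "solitary waves on
lattices|Friesecke" --star all (17 rows, 0 relevant), "shell model|dyadic model" --star pdf (8 rows,
0 relevant); lean search InTableClass / dyadicTable / NoSurvivingEternalBdd; ledger negatives
--problem NavierStokesRegularity (5 entries, none near); OpenAlex/S2 in HTTP-429 cool-down (not
dialled).
Nearest prior art found: doi:10.1016/S0167-2789(99)00190-6 (Andersen et al. 2000, zero-spacing
continuum limit of GOY with pulses, via [corpus:paper:arxiv-1409.4682 p.3]); arXiv:1409.4682
(Mailybaev 2015, blow-up as a travelling wave in renormalised variables at FIXED λ); in the tree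
route-NavierStokesRegularity-TaoLadderRungTwoBreak rev 12 (ρ0's why-might-fail names the λ → 1
solitary wave as the enemy, files no limit-lattice statement).
Delta: the DISCRETE λ = 1 limit lattice of a comparable-table cascade and its no-transit Liouvi  [refs: 10.1016/S0167-2789(99, 1409.4682, arxiv-0811.2406, arxiv-1502.03937, arxiv-1409.4682, arxiv-2501.07377, arxiv-2005.14027, arxiv-2412.07064, doi:10.1016/S0167-2789, paper:arxiv-1409.4682, book:lombardi2000]

Barriers (technique_class: limit-lattice-liouville lattice-travelling-waves): - technique_class: limit-lattice-liouville lattice-travelling-waves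
- Literature.Barriers.NavierStokesRegularity.TaoAveragedBlowup: Tao's blow-up table has spread ≍
ε⁻²e^(K¹⁰) slaved to ε₀ (1/ε₀ ≪ K ≪ 1/ε); at fixed spread R with ε₀ → 0 the hierarchy is absent —
the rung and this line live in exactly that complementary regime, and the barrier does not quantify
over λ = 1 lattices.
- Literature.Barriers.NavierStokesRegularity.AveragedTypeIBlowup: a Type-I averaged blow-up exists
for SOME table at SOME fixed ε₀ (PerpetualPump crux 3); the line asserts nothing table-free — only
sub-threshold ε₀ on E₂(R) — and its deciding crux concerns the ε₀ → 0 limit object, where a fixed-ε₀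
construction does not live; the dictionary maps that pump to a pulse WITH wake.
- Literature.Barriers.NavierStokesRegularity.DyadicCascadeRegularity: same side as the line (the
dyadic member is regular); a consistency check, not evaded.
- Literature.Barriers.NavierStokesRegularity.EnergySupercriticality: not engaged — the lattice
statement is scale-free (λ = 1) and uses exact energy conservation plus a second monotone functional
(mass creation), not a coercive supercritical bound.
- Negatives index: stmt-1832 (PerpetualPump thesis, refuted) concerned a fixed-ε₀ pump; stmt-1376,
4055, 1429, 0154 are unrelated; no refuted statement mentions limit lattices — nothing re-asked.

sub-problem: NavierStokesRegularity · status: open · opened planner-ns-idea-4-g0-0 2026-08-27T20:34:44Z · rev 3 · ledger route-NavierStokesRegularity-LatticeTransitLiouville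
GENERATED by the gate from the ledger (D-0016/17). Provers cite these decls: `theorem foo : Summit.NavierStokesRegularity.NavierStokesRegularity.Theses.LatticeTransitLiouville.<Decl> := …` in Summits/NavierStokesRegularity/NavierStokesRegularity/Theorems/<Name>.lean.
-/

namespace Summit.NavierStokesRegularity.NavierStokesRegularity.Theses.LatticeTransitLiouville

open scoped BigOperators Topology Manifold Classical MeasureTheory ProbabilityTheory Matrix InnerProductSpace ComplexConjugate ContinuousMap
open Filter Set Function TopologicalSpace MeasureTheory

attribute [summit_statement] _root_.NavierStokesRegularity
attribute [summit_statement] _root_.Summit.NavierStokesRegularity.NavierStokesRegularity.Theses.TaoLadderRungTwoBreak.Target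

open Literature.NS

/-- item stmt-NavierStokesRegularity-22148 · crux · rank 2 · open · by planner
why it might fail: E₂(R) is a ≥10-parameter compact family; exact tail-free pulses are codimension-one in reversible advance-delay problems (Lombardi) and compact sonic-vacuum pulses exist in purely nonlinear chains (Nesterenko; English–Pego 2005) — one such pulse for one comparable table kills it.
sources: doi:10.1007/BF02101552, book:lombardi2000-oscillatory-integrals-phenomena-beyond-all-algebriac-orders, doi:10.1090/S0002-9939-05-07851-2, arXiv:1402.0290
[crux] for every R ≥ 1 and every table α ∈ E₂(R) (InTableClass R α), every solution V : ℤ → ℝ → ℝ⁴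
of the λ = 1 lattice 𝓛_α that is bounded, non-evanescent (sup_n ‖V_n(s)‖ ≥ c > 0 for all s),
square-summable at each time, drains below every shell as s → +∞ and vanishes above every shell as s
→ −∞, is identically zero (card item K1). [difficulty: L] -/
@[route_item "route-NavierStokesRegularity-LatticeTransitLiouville", crux]
def NoLatticeTransit : Prop :=
  ∀ R : ℝ, 1 ≤ R → ∀ α : Fin 4 → Fin 4 → Fin 4 → ℤ × ℤ × ℤ → ℝ, Literature.Analysis.FluidPDE.TaoCascade.InTableClass R α → ∀ V : ℤ → ℝ → EuclideanSpace ℝ (Fin 4), (∀ (n : ℤ) (s : ℝ), HasDerivAt (V n) (Literature.Analysis.FluidPDE.TaoCascade.tableQ α (V n s) + Literature.Analysis.FluidPDE.TaoCascade.tableA α (V (n - 1) s) + Literature.Analysis.FluidPDE.TaoCascade.tableB α (V (n + 1) s) (V n s)) s) → (∃ C : ℝ, ∀ (n : ℤ) (s : ℝ), ‖V n s‖ ≤ C) → (∃ c : ℝ, 0 < c ∧ ∀ s : ℝ, ∃ n : ℤ, c ≤ ‖V n s‖) → (∀ s : ℝ, Summable (fun n : ℤ => ‖V n s‖ ^ 2))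 → (∀ N : ℤ, Filter.Tendsto (fun s : ℝ => ∑' k : ℕ, ‖V (N - (k : ℤ)) s‖ ^ 2) Filter.atTop (nhds 0)) → (∀ N : ℤ, Filter.Tendsto (fun s : ℝ => ∑' k : ℕ, ‖V (N + (k : ℤ)) s‖ ^ 2) Filter.atBot (nhds 0)) → ∀ (n : ℤ) (s : ℝ), V n s = 0

/-- item stmt-NavierStokesRegularity-22149 · crux · rank 3 · open · by planner
why it might fail: the amplitude rate ‖W‖∞ ≍ 1/ε₀ is unproved (UniformBound carries no rate); fronts may widen or split as ε₀ → 0 (vanishing/dichotomy), and survival — an ε₀-clock statement — may pass to the limit only as partial drain.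
sources: arXiv:1402.0290, doi:10.1007/BF02101552, Literature.Analysis.FluidPDE.Tao2016AveragedNS.BoundedEternalSolutions
[crux] if NoSurvivingEternalBdd R 1 fails (survivors W_(ε₀) for ε₀ → 0 on tables α_(ε₀) ∈ E₂(R)),
then recentring at the front, rescaling amplitude by ‖W‖∞ and time by ‖W‖∞⁻¹ and passing to a
diagonal limit (E₂(R) is compact) yields a limit table α ∈ E₂(R) and a bounded, non-evanescent,
finite-energy, completely draining, nontrivial eternal solution of 𝓛_α (card item K2). [difficulty:
L] -/
@[route_item "route-NavierStokesRegularity-LatticeTransitLiouville", crux]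
def TransitExtraction : Prop :=
  ∀ R : ℝ, 1 ≤ R → ¬ Literature.Analysis.FluidPDE.TaoCascade.NoSurvivingEternalBdd R 1 → ∃ α : Fin 4 → Fin 4 → Fin 4 → ℤ × ℤ × ℤ → ℝ, Literature.Analysis.FluidPDE.TaoCascade.InTableClass R α ∧ ∃ V : ℤ → ℝ → EuclideanSpace ℝ (Fin 4), (∀ (n : ℤ) (s : ℝ), HasDerivAt (V n) (Literature.Analysis.FluidPDE.TaoCascade.tableQ α (V n s) + Literature.Analysis.FluidPDE.TaoCascade.tableA α (V (n - 1) s) + Literature.Analysis.FluidPDE.TaoCascade.tableB α (V (n + 1) s) (V n s)) s) ∧ (∃ C : ℝ, ∀ (n : ℤ) (s : ℝ), ‖V n s‖ ≤ C) ∧ (∃ c : ℝ, 0 < c ∧ ∀ s : ℝ, ∃ n : ℤ, c ≤ ‖V n s‖) ∧ (∀ s : ℝ, Summable (fun n : ℤ => ‖V n s‖ ^ 2)) ∧ (∀ N : ℤ, Filter.Tendsto (fun s : ℝ => ∑' k : ℕ, ‖V (N - (k : ℤ)) s‖ ^ 2) Filter.atTop (nhds 0)) ∧ (∀ N : ℤ,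 Filter.Tendsto (fun s : ℝ => ∑' k : ℕ, ‖V (N + (k : ℤ)) s‖ ^ 2) Filter.atBot (nhds 0)) ∧ ∃ (n : ℤ) (s : ℝ), V n s ≠ 0

/-- item stmt-NavierStokesRegularity-20452 · crux · rank 4 · open · by planner
why it might fail: a viscous eternal solution in which every shell reaches the dissipation-critical level yet the front still outruns dissipation at small ε₀ (a "loud" surviving ladder) is not excluded by any census so far.
sources: arXiv:1402.0290, Literature.Analysis.FluidPDE.Tao2016AveragedNS.BoundedEternalSolutions
[crux, split child (ρ+) of NoSurvivingEternalViscBddOne] loud-ladder exclusion: below a threshold,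
no table of InTableClass R carries a uniformly bounded admissible viscous eternal solution with ν̂ >
0 in which EVERY shell's weighted energy reaches the dissipation-critical level ν̂²/4096 and which
is (S₁)-surviving forward (the complement of the PROVED seeded slice noSurvivingViscSeededBdd R
4096). m = 1 prototype: BMR 2011 dyadic regularity. -/
@[route_item "route-NavierStokesRegularity-LatticeTransitLiouville", crux]
def NoLoudLadderOne : Prop :=
  ∀ R : ℝ, 1 ≤ R → Literature.Analysis.FluidPDE.TaoCascade.NoLoudLadder R

/-- item stmt-NavierStokesRegularity-20420 · crux · rank 5 · open · by planner
why it might fail: the compactness step from defect-tolerant blow-up (NoGlobalCascade fails) to a UNIFORMLY BOUNDED eternal solution needs a Type-I bound that a Type-II-like cascade on a comparable table might violate.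
sources: arXiv:1402.0290, Literature.Analysis.FluidPDE.Tao2016AveragedNS.BoundedEternalSolutions
[crux, consequence-crux consumed by closes] K2ᵛ(1): for every R ≥ 1 there is a threshold below which
robust blow-up (NoGlobalCascade ε₀ α X₀) of a table α ∈ InTableClass R from a one-shell datum yields
ν̂ ≥ 0 and a uniformly bounded admissible viscous eternal solution W (IsEternalVisc ε₀ ν̂ α W ∧
UniformBound W) surviving forward at a = 1 — the ω-limit of the type-I-renormalised blow-up
trajectory modulo shell shift. Implied by the Target (vacuously) and by rev-1's BlowupRigidityOne.
Model lattice ODEs only. -/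
@[route_item "route-NavierStokesRegularity-LatticeTransitLiouville", crux]
def EternalRigidityViscBddOne : Prop :=
  ∀ R : ℝ, 1 ≤ R → Literature.Analysis.FluidPDE.TaoCascade.EternalRigidityViscBdd R 1

/-- item stmt-NavierStokesRegularity-22150 · assembly · rank 1 · closed · proved by Summit.NavierStokesRegularity.NavierStokesRegularity.Theorems.latticeTransitLiouville_assembly_proof (prover) · by planner
sources: arXiv:1402.0290, Literature.Analysis.FluidPDE.Tao2016AveragedNS.BoundedEternalSolutions
[assembly] TransitExtraction → NoLatticeTransit → NoLoudLadderOne → EternalRigidityViscBddOne → rung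
target TaoLadderRungTwoBreak.Target (∀ R ≥ 1, NoRobustBlowupBelow R). -/
@[route_item "route-NavierStokesRegularity-LatticeTransitLiouville"]
def Assembly : Prop :=
  TransitExtraction → NoLatticeTransit → NoLoudLadderOne → EternalRigidityViscBddOne → Summit.NavierStokesRegularity.NavierStokesRegularity.Theses.TaoLadderRungTwoBreak.Target

-- `Assembly` holds: proved by `Summit.NavierStokesRegularity.NavierStokesRegularity.Theorems.latticeTransitLiouville_assembly_proof` (its module imports this route file, so no `_holds` link can be stated here).

/-! D-0027 §2.1 — DECIDING THEOREM (planner-authored via `route open/edit --closes-file`; by planner-ns-idea-4-g0-0 2026-08-27T20:34:44Z):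
its hypotheses are this route's items and its conclusion the registered leaf `Summit.NavierStokesRegularity.NavierStokesRegularity.Theses.TaoLadderRungTwoBreak.Target` (rung TL-M2Break, D-0061) (glue_lint), and it elaborates with this file. -/

@[closes "route-NavierStokesRegularity-LatticeTransitLiouville"] theorem closes (h1 : TransitExtraction) (h2 : NoLatticeTransit) (h3 : NoLoudLadderOne)
    (h4 : EternalRigidityViscBddOne) :
    Summit.NavierStokesRegularity.NavierStokesRegularity.Theses.TaoLadderRungTwoBreak.Target := by
  intro R hR
  have h0 : Literature.Analysis.FluidPDE.TaoCascade.NoSurvivingEternalBdd R 1 := by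
    by_contra h
    obtain ⟨α, hα, V, hl, hb, hc, hs, hf, hbk, n, s, hne⟩ := h1 R hR h
    exact hne (h2 R hR α hα V hl hb hc hs hf hbk n s)
  exact Literature.Analysis.FluidPDE.TaoCascade.noRobustBlowupBelow_of_eternalViscBdd
    (Literature.Analysis.FluidPDE.TaoCascade.noSurvivingEternalViscBddOne_of h0 (h3 R hR)) (h4 R hR)

end Summit.NavierStokesRegularity.NavierStokesRegularity.Theses.LatticeTransitLiouville
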